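import Literature.MathematicalPhysics.KineticTheory.VelocityAveraging
import Mathlib.MeasureTheory.Integral.IntervalIntegral.FundThmCalculus
import Mathlib.MeasureTheory.Integral.Prod
import HarnessLib

/-!
# The Duhamel (characteristics) integral of an `L¹` source for the free transport operator in `𝒟'`

Topic: MathematicalPhysics / KineticTheory. Infrastructure for the `L¹` velocity-averaging lemma
(CIP 1994 Lemma 5.3.9, `velocityAverage_relativelyCompact_L1` of `VelocityAveraging`): the
free-transport characteristics `s ↦ (t - s, x - sξ, ξ)` on phase space-time `ℝ × E × E` (the
*lag shear*), their measure preservation, and the **source Duhamel integral**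
`(sourceDuhamel F)(t, x, ξ) = ∫_{s > 0} F(t - s, x - sξ, ξ) ds`
of an integrable source `F` vanishing for early times, which is the solution of
`(∂ₜ + ξ·∇ₓ) u = F` in `𝒟'(ℝ × E × E)` vanishing for early times (CIP 1994, §5.3, p. 155:
"`gₙ` is the unique solution of `T f = T gₙ`, `f|_{t=0} = 0`", and the displayed formula
`hₙ(x + tξ, ξ, t) = ∫₀ᵗ (Tgₙ · χ)(x + τξ, ξ, τ) dτ`; the method of characteristics,
Saint-Raymond 2009, §3.3.1, "`fₙ(t,x,v) = ∫_{-∞}^t Sₙ(s, x - v(t-s), v) ds`"). Everything here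
is proved; theorems only besides the three definitions `shear`, `shearEquiv`, `sourceDuhamel`.

* `shear s z = (t - s, x - sξ, ξ)`, a measurable equivalence `shearEquiv s` of `ℝ × E × E`
  preserving Lebesgue measure (`measurePreserving_shear`).
* `sourceDuhamel F`, its vanishing for `t ≤ a` when `F` vanishes there, the finite-time formula
  `sourceDuhamel F z = ∫_{0<s<S} F (shear s z)` (`sourceDuhamel_eq_setIntegral_Ioo`), the sup
  bound `|sourceDuhamel F z| ≤ S · C` and the `L¹` bound on time slabs
  `∫_{t<b} |sourceDuhamel F| ≤ (b - a) ‖F‖₁` (`lintegral_sourceDuhamel_le`), strong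
  measurability, and the a.e. integrability of the characteristics integrand
  (`ae_integrableOn_shear`).
* `hasDistribTransportOn_sourceDuhamel`: `T (sourceDuhamel F) = F` in `𝒟'(ℝ × E × E)`
  (`HasDistribTransportOn univ`), by Fubini, the measure preservation of the shears and the
  fundamental theorem of calculus along characteristics.

Uniqueness (that every distributional solution vanishing for early times *is* `sourceDuhamel F`)
is the sequel `FreeTransportUniqueness`.

## Relation to the other characteristics toolkits of this topic

* `TransportDuhamel` (`contDiff_duhamel`, `duhamel_transport_eq`, `duhamel_weighted_bound_zero`,
  …) treats a *different* Duhamel formula: the smooth absorption problem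
  `∂ₜU + v·∇ₓU = Γ - ΛU`, `U(0) = f₀` on `[0, T]`, with smooth data and the candidate `U` entering
  by hypothesis (no definition), for the Picard iteration of the truncated problems. Here the
  source is merely `L¹`, there is no initial datum (the solution vanishes for early times) and the
  equation holds in `𝒟'`.
* `shearFlow` (`DiPernaLionsLimitProofs`) is the *straightening* map `(t, x, v) ↦ (t, x + tv, v)`
  (`g ∘ shearFlow = g♯`), and `measurePreserving_freeShear` there (an instance of
  `Literature.Analysis.FluidPDE.measurePreserving_shear`, `HardSpherePhaseSpaceProofs`) is the
  invariance of `dx dv` under `(x, v) ↦ (x + tv, v)`; the present `shear s` is the *lag* shear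
  `(t, x, ξ) ↦ (t - s, x - sξ, ξ)` acting also on time, whose `(x, ξ)`-part is re-proved below in
  three lines rather than importing the Boltzmann files. Likewise the continuity of `Tφ`
  (`continuous_transportDeriv`, `DiPernaLionsVelocityAverages`) and its vanishing off
  `tsupport φ` (`transportDeriv_eq_zero_of_notMem_tsupport`, `VelocityAveragingFourier`) are
  used through short local copies to keep the import closure of this file at `VelocityAveraging`;
  a librarian may move these three lemmas into `VelocityAveraging`.

## References

* C. Cercignani, R. Illner, M. Pulvirenti, *The Mathematical Theory of Dilute Gases*, Springer
  (1994), §5.3, proof of Lemma 5.3.9, p. 155. [CIP1994]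
* L. Saint-Raymond, *Hydrodynamic Limits of the Boltzmann Equation*, LNM 1971 (2009), §3.3.1
  (method of characteristics for `St ∂ₜ f + v·∇ₓ f = S`). [SaintRaymond2009]
-/
noncomputable section

open MeasureTheory Set Filter Function intervalIntegral
open _root_.Topology
open scoped ENNReal NNReal ContDiff

namespace Literature.MathematicalPhysics.KineticTheory

/-! ## The free-transport shear -/

section Shear

variable {E : Type*} [NormedAddCommGroup E] [NormedSpace ℝ E]

/-- The backward free-transport characteristic map at lag `s`:
`shear s (t, x, ξ) = (t - s, x - s ξ, ξ)` (CIP 1994 §5.3, p. 155; Saint-Raymond 2009 §3.3.1). [folklore] -/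
def shear (s : ℝ) (z : ℝ × E × E) : ℝ × E × E :=
  (z.1 - s, z.2.1 - s • z.2.2, z.2.2)

/-- Unfolding of `shear`. [folklore] -/
@[simp] theorem shear_apply (s : ℝ) (z : ℝ × E × E) :
    shear s z = (z.1 - s, z.2.1 - s • z.2.2, z.2.2) := rfl

/-- `shear 0 = id`. [folklore] -/
@[simp] theorem shear_zero (z : ℝ × E × E) : shear 0 z = z := by
  simp [shear]

/-- The shears form a flow: `shear s (shear s' z) = shear (s + s') z`. [folklore] -/
theorem shear_shear (s s' : ℝ) (z : ℝ × E × E) :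
    shear s (shear s' z) = shear (s + s') z := by
  simp only [shear, Prod.mk.injEq, add_smul]
  exact ⟨by ring, by abel, trivial⟩

/-- `shear (-s)` moves forward along the characteristic: `shear (-s) z = z + s • (1, ξ, 0)`. [folklore] -/
theorem shear_neg_eq_add_smul (s : ℝ) (z : ℝ × E × E) :
    shear (-s) z = z + s • ((1 : ℝ), z.2.2, (0 : E)) := by
  ext <;> simp [shear, sub_neg_eq_add, neg_smul]

/-- The shear is jointly continuous in the lag and the point. [folklore] -/
theorem continuous_shear_uncurry : Continuous fun q : ℝ × (ℝ × E × E) => shear q.1 q.2 := by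
  unfold shear
  fun_prop

/-- Each shear is continuous. [folklore] -/
theorem continuous_shear (s : ℝ) : Continuous (shear (E := E) s) := by
  unfold shear
  fun_prop

/-- The shear as a product map: a time translation times the phase-space shear. [folklore] -/
theorem shear_eq_prodMap (s : ℝ) :
    shear (E := E) s = Prod.map (fun t : ℝ => t - s) (fun q : E × E => (q.1 - s • q.2, q.2)) := by
  funext z
  rfl

variable [FiniteDimensional ℝ E] [MeasurableSpace E] [BorelSpace E]

/-- Each shear is measurable. [folklore] -/
theorem measurable_shear (s : ℝ) : Measurable (shear (E := E) s) :=
  (continuous_shear s).measurable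

/-- The shear at lag `s` as a measurable equivalence of phase space-time, with inverse the shear
at lag `-s`. [folklore] -/
def shearEquiv (s : ℝ) : (ℝ × E × E) ≃ᵐ (ℝ × E × E) where
  toFun := shear s
  invFun := shear (-s)
  left_inv z := by rw [shear_shear, neg_add_cancel, shear_zero]
  right_inv z := by rw [shear_shear, add_neg_cancel, shear_zero]
  measurable_toFun := measurable_shear s
  measurable_invFun := measurable_shear (-s)

/-- Unfolding of `shearEquiv`. [folklore] -/
@[simp] theorem shearEquiv_apply (s : ℝ) (z : ℝ × E × E) : shearEquiv s z = shear s z := rfl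

/-- Unfolding of the inverse of `shearEquiv`. [folklore] -/
@[simp] theorem shearEquiv_symm_apply (s : ℝ) (z : ℝ × E × E) :
    (shearEquiv s).symm z = shear (-s) z := rfl

/-- The characteristics integrand `(z, s) ↦ F (shear s z)` is jointly measurable for measurable
`F`. [folklore] -/
theorem measurable_comp_shear {F : ℝ × E × E → ℝ} (hFm : Measurable F) :
    Measurable fun q : (ℝ × E × E) × ℝ => F (shear q.2 q.1) :=
  hFm.comp (continuous_shear_uncurry.measurable.comp (measurable_snd.prodMk measurable_fst))

/-- For a fixed point, the characteristics integrand `s ↦ F (shear s z)` is measurable. [folklore] -/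
theorem measurable_comp_shear_left {F : ℝ × E × E → ℝ} (hFm : Measurable F) (z : ℝ × E × E) :
    Measurable fun s : ℝ => F (shear s z) :=
  hFm.comp (continuous_shear_uncurry.measurable.comp (measurable_id.prodMk measurable_const))

end Shear

/-! ## The source Duhamel integral -/

section Duhamel

variable {E : Type*} [NormedAddCommGroup E] [NormedSpace ℝ E]

/-- The **source Duhamel integral** of a source `F` along the free-transport characteristics,
`(sourceDuhamel F)(t, x, ξ) = ∫_{s > 0} F(t - s, x - sξ, ξ) ds` (Bochner integral over `s ∈ (0, ∞)`,
junk value `0` where the integrand is not integrable). For `F` vanishing for `t ≤ a` only lags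
`s < t - a` contribute (CIP 1994, §5.3, p. 155; Saint-Raymond 2009, §3.3.1). [cite: CIP1994, §5.3 proof of Lemma 5.3.9, p. 155] -/
def sourceDuhamel (F : ℝ × E × E → ℝ) (z : ℝ × E × E) : ℝ :=
  ∫ s in Ioi (0 : ℝ), F (shear s z)

/-- Unfolding of `sourceDuhamel`. [folklore] -/
theorem sourceDuhamel_apply (F : ℝ × E × E → ℝ) (z : ℝ × E × E) :
    sourceDuhamel F z = ∫ s in Ioi (0 : ℝ), F (shear s z) := rfl

/-- If `F` vanishes for times `≤ a`, the characteristics integrand at a point of time `t` vanishes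
for lags `s ≥ t - a`. [folklore] -/
theorem apply_shear_eq_zero_of_le {F : ℝ × E × E → ℝ} {a : ℝ} (hF : ∀ z, z.1 ≤ a → F z = 0)
    (z : ℝ × E × E) {s : ℝ} (hs : z.1 - a ≤ s) : F (shear s z) = 0 :=
  hF _ (by simp only [shear]; linarith)

/-- **Finite-time formula**: if `F` vanishes for times `≤ a` and `z.1 - a ≤ S`, then
`sourceDuhamel F z = ∫_{0 < s < S} F (shear s z) ds`. [folklore] -/
theorem sourceDuhamel_eq_setIntegral_Ioo {F : ℝ × E × E → ℝ} {a : ℝ} (hF : ∀ z, z.1 ≤ a → F z = 0)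
    (z : ℝ × E × E) {S : ℝ} (hS : z.1 - a ≤ S) :
    sourceDuhamel F z = ∫ s in Ioo (0 : ℝ) S, F (shear s z) := by
  rw [sourceDuhamel_apply]
  refine setIntegral_eq_of_subset_of_forall_sdiff_eq_zero measurableSet_Ioi
    (fun s hs => hs.1) fun s hs => apply_shear_eq_zero_of_le hF z ?_
  rcases hs with ⟨hs0, hs'⟩
  by_contra h
  exact hs' ⟨hs0, by linarith⟩

/-- If `F` vanishes for times `≤ a`, so does `sourceDuhamel F`. [folklore] -/
theorem sourceDuhamel_eq_zero_of_le {F : ℝ × E × E → ℝ} {a : ℝ} (hF : ∀ z, z.1 ≤ a → F z = 0)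
    (z : ℝ × E × E) (hz : z.1 ≤ a) : sourceDuhamel F z = 0 := by
  rw [sourceDuhamel_eq_setIntegral_Ioo hF z (S := 0) (by linarith), Ioo_self, Measure.restrict_empty,
    integral_zero_measure]

/-- **Sup bound**: if `F` vanishes for times `≤ a`, `|F| ≤ C`, and `z.1 - a ≤ S` with `0 ≤ S`,
then `|sourceDuhamel F z| ≤ S · C`. [folklore] -/
theorem abs_sourceDuhamel_le {F : ℝ × E × E → ℝ} {a : ℝ} (hF : ∀ z, z.1 ≤ a → F z = 0) {C : ℝ}
    (hC : ∀ z, |F z| ≤ C) (z : ℝ × E × E) {S : ℝ} (hS : z.1 - a ≤ S) (hS0 : 0 ≤ S) :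
    |sourceDuhamel F z| ≤ S * C := by
  rw [sourceDuhamel_eq_setIntegral_Ioo hF z hS]
  have h := norm_setIntegral_le_of_norm_le_const (μ := (volume : Measure ℝ)) (s := Ioo (0 : ℝ) S)
    (f := fun s => F (shear s z)) (C := C) (by simp) fun s _ => by
      rw [Real.norm_eq_abs]; exact hC _
  rw [Real.norm_eq_abs, Real.volume_real_Ioo_of_le hS0, sub_zero] at h
  linarith [h, mul_comm C S]

end Duhamel

/-! ## Measurability, measure preservation and integrability -/

section Measurable

variable {E : Type*} [NormedAddCommGroup E] [NormedSpace ℝ E] [FiniteDimensional ℝ E]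
  [MeasurableSpace E] [BorelSpace E]

/-- `sourceDuhamel F` is strongly measurable for measurable `F`. [folklore] -/
theorem stronglyMeasurable_sourceDuhamel {F : ℝ × E × E → ℝ} (hFm : Measurable F) :
    StronglyMeasurable (sourceDuhamel F) :=
  (measurable_comp_shear hFm).stronglyMeasurable.integral_prod_right'
    (ν := (volume : Measure ℝ).restrict (Ioi 0))

/-- `sourceDuhamel F` is measurable for measurable `F`. [folklore] -/
theorem measurable_sourceDuhamel {F : ℝ × E × E → ℝ} (hFm : Measurable F) :
    Measurable (sourceDuhamel F) :=
  (stronglyMeasurable_sourceDuhamel hFm).measurable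

end Measurable

section Volume

variable {E : Type*} [NormedAddCommGroup E] [InnerProductSpace ℝ E] [FiniteDimensional ℝ E]
  [MeasurableSpace E] [BorelSpace E]

/-- **The free-transport lag shear preserves Lebesgue measure** on `ℝ × E × E` (it is a time
translation times the unimodular linear shear `(x, ξ) ↦ (x - sξ, ξ)`; Liouville for free
transport; cf. `measurePreserving_freeShear` in `DiPernaLionsLimitProofs` and
`Literature.Analysis.FluidPDE.measurePreserving_shear` for the `(x, ξ)`-part with lag `-s`). [folklore] -/
theorem measurePreserving_shear (s : ℝ) :
    MeasurePreserving (shear (E := E) s) volume volume := by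
  -- `(x, ξ) ↦ (x - s ξ, ξ)` preserves `volume` on `E × E`: conjugate a skew product by the swap
  have h1 : MeasurePreserving (fun q : E × E => (q.1, q.2 - s • q.1))
      (volume : Measure (E × E)) volume := by
    refine (MeasurePreserving.id volume).skew_product (g := fun ξ x => x - s • ξ)
      (by fun_prop) (ae_of_all _ fun ξ => ?_)
    exact (measurePreserving_sub_right volume (s • ξ)).map_eq
  have hswap : MeasurePreserving (Prod.swap : E × E → E × E) (volume : Measure (E × E)) volume :=
    Measure.measurePreserving_swap
  have h2 : MeasurePreserving (fun q : E × E => (q.1 - s • q.2, q.2))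
      (volume : Measure (E × E)) volume := by
    have hfun : (fun q : E × E => (q.1 - s • q.2, q.2)) =
        Prod.swap ∘ (fun q : E × E => (q.1, q.2 - s • q.1)) ∘ Prod.swap := by
      funext q; rfl
    rw [hfun]
    exact hswap.comp (h1.comp hswap)
  have h3 : MeasurePreserving (fun t : ℝ => t - s) volume volume := measurePreserving_sub_right _ s
  rw [shear_eq_prodMap]
  exact h3.prod h2

/-- Tonelli along characteristics: `∫⁻ z, ∫⁻_{s ∈ I} ‖F (shear s z)‖ = |I| · ‖F‖_{L¹}` for a
bounded interval `I = (0, S)`. [folklore] -/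
theorem lintegral_lintegral_shear_eq {F : ℝ × E × E → ℝ} (hFm : Measurable F) (S : ℝ) :
    ∫⁻ z, ∫⁻ s in Ioo (0 : ℝ) S, ‖F (shear s z)‖ₑ ∂volume ∂volume =
      ENNReal.ofReal S * ∫⁻ z, ‖F z‖ₑ ∂volume := by
  have hm : Measurable fun q : (ℝ × E × E) × ℝ => ‖F (shear q.2 q.1)‖ₑ :=
    (measurable_comp_shear hFm).enorm
  rw [lintegral_lintegral_swap (hm.aemeasurable (μ := volume.prod (volume.restrict (Ioo 0 S))))]
  have hin : ∀ s, ∫⁻ z, ‖F (shear s z)‖ₑ ∂volume = ∫⁻ z, ‖F z‖ₑ ∂volume := fun s =>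
    (measurePreserving_shear s).lintegral_comp_emb (shearEquiv s).measurableEmbedding
      (fun z => ‖F z‖ₑ)
  simp_rw [hin]
  rw [lintegral_const, Measure.restrict_apply_univ, Real.volume_Ioo, sub_zero, mul_comm]

/-- **`L¹` bound on time slabs**: if `F` is integrable and vanishes for times `≤ a`, then
`∫_{t < b} |sourceDuhamel F| ≤ (b - a) ‖F‖_{L¹}` (each characteristic shear preserves the measure;
CIP 1994, p. 155: "`∫∫∫ |hₙ| dx dξ dt → 0` uniformly in `n`"). [folklore] -/
theorem lintegral_sourceDuhamel_le {F : ℝ × E × E → ℝ} (hFm : Measurable F) {a : ℝ}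
    (hF : ∀ z, z.1 ≤ a → F z = 0) (b : ℝ) :
    ∫⁻ z in {z : ℝ × E × E | z.1 < b}, ‖sourceDuhamel F z‖ₑ ∂volume ≤
      ENNReal.ofReal (b - a) * ∫⁻ z, ‖F z‖ₑ ∂volume := by
  calc ∫⁻ z in {z : ℝ × E × E | z.1 < b}, ‖sourceDuhamel F z‖ₑ ∂volume
        ≤ ∫⁻ z in {z : ℝ × E × E | z.1 < b}, ∫⁻ s in Ioo (0 : ℝ) (b - a), ‖F (shear s z)‖ₑ
            ∂volume ∂volume := by
          refine setLIntegral_mono' (measurableSet_lt measurable_fst measurable_const)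
            fun z hz => ?_
          rw [sourceDuhamel_eq_setIntegral_Ioo hF z (S := b - a) (by simp only [mem_setOf_eq] at hz; linarith)]
          exact enorm_integral_le_lintegral_enorm _
    _ ≤ ∫⁻ z, ∫⁻ s in Ioo (0 : ℝ) (b - a), ‖F (shear s z)‖ₑ ∂volume ∂volume :=
          setLIntegral_le_lintegral _ _
    _ = ENNReal.ofReal (b - a) * ∫⁻ z, ‖F z‖ₑ ∂volume := lintegral_lintegral_shear_eq hFm _

/-- `sourceDuhamel F` is integrable on every time slab `{t < b}` when `F` is integrable and vanishes for
early times. [folklore] -/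
theorem integrableOn_sourceDuhamel {F : ℝ × E × E → ℝ} (hFm : Measurable F) (hFi : Integrable F volume)
    {a : ℝ} (hF : ∀ z, z.1 ≤ a → F z = 0) (b : ℝ) :
    IntegrableOn (sourceDuhamel F) {z : ℝ × E × E | z.1 < b} volume := by
  refine ⟨(stronglyMeasurable_sourceDuhamel hFm).aestronglyMeasurable, ?_⟩
  refine (lintegral_sourceDuhamel_le hFm hF b).trans_lt ?_
  exact ENNReal.mul_lt_top ENNReal.ofReal_lt_top hFi.2

/-- `sourceDuhamel F` is locally integrable when `F` is integrable and vanishes for early times. [folklore] -/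
theorem locallyIntegrable_sourceDuhamel {F : ℝ × E × E → ℝ} (hFm : Measurable F)
    (hFi : Integrable F volume) {a : ℝ} (hF : ∀ z, z.1 ≤ a → F z = 0) :
    LocallyIntegrable (sourceDuhamel F) volume := fun z =>
  ⟨{w : ℝ × E × E | w.1 < z.1 + 1}, (isOpen_lt continuous_fst continuous_const).mem_nhds
    (by simp), integrableOn_sourceDuhamel hFm hFi hF _⟩

/-- For a.e. point `z`, the characteristics integrand `s ↦ F (shear s z)` is integrable on
`(0, ∞)` (`F` integrable, vanishing for early times; Tonelli on time slabs). [folklore] -/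
theorem ae_integrableOn_shear {F : ℝ × E × E → ℝ} (hFm : Measurable F) (hFi : Integrable F volume)
    {a : ℝ} (hF : ∀ z, z.1 ≤ a → F z = 0) :
    ∀ᵐ z ∂(volume : Measure (ℝ × E × E)), IntegrableOn (fun s => F (shear s z)) (Ioi 0) := by
  have hmz : ∀ z : ℝ × E × E, Measurable fun s : ℝ => F (shear s z) :=
    measurable_comp_shear_left hFm
  -- on each slab `{t < n}` the `(0, n - a)` part has finite integral a.e.
  have hfin : ∀ n : ℕ, ∀ᵐ z ∂(volume : Measure (ℝ × E × E)),
      ∫⁻ s in Ioo (0 : ℝ) (n - a), ‖F (shear s z)‖ₑ < ⊤ := fun n => by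
    refine ae_lt_top' ?_ ?_
    · exact ((measurable_comp_shear hFm).enorm.lintegral_prod_right'
        (ν := volume.restrict (Ioo (0 : ℝ) (n - a)))).aemeasurable
    · rw [lintegral_lintegral_shear_eq hFm]
      exact (ENNReal.mul_lt_top ENNReal.ofReal_lt_top hFi.2).ne
  rw [← ae_all_iff] at hfin
  filter_upwards [hfin] with z hz
  obtain ⟨n, hn⟩ := exists_nat_gt z.1
  have h1 : IntegrableOn (fun s => F (shear s z)) (Ioo 0 (n - a)) :=
    ⟨(hmz z).aestronglyMeasurable, hz n⟩
  have h2 : IntegrableOn (fun s => F (shear s z)) (Ici ((n : ℝ) - a)) := by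
    refine integrableOn_zero.congr_fun (fun s hs => ?_) measurableSet_Ici
    exact (apply_shear_eq_zero_of_le hF z (by linarith [mem_Ici.1 hs])).symm
  by_cases hna : 0 < (n : ℝ) - a
  · rw [← Ioo_union_Ici_eq_Ioi hna]
    exact h1.union h2
  · exact h2.mono_set fun s hs => mem_Ici.2 ((not_lt.1 hna).trans (le_of_lt hs))

/-- **Linearity a.e.**: `sourceDuhamel (F + G) = sourceDuhamel F + sourceDuhamel G` almost everywhere, for
integrable sources vanishing for early times. [folklore] -/
theorem sourceDuhamel_add_ae {F G : ℝ × E × E → ℝ} (hFm : Measurable F) (hFi : Integrable F volume)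
    (hGm : Measurable G) (hGi : Integrable G volume) {a : ℝ} (hF : ∀ z, z.1 ≤ a → F z = 0)
    (hG : ∀ z, z.1 ≤ a → G z = 0) :
    sourceDuhamel (F + G) =ᵐ[volume] sourceDuhamel F + sourceDuhamel G := by
  filter_upwards [ae_integrableOn_shear hFm hFi hF, ae_integrableOn_shear hGm hGi hG] with z hzF hzG
  simp only [sourceDuhamel_apply, Pi.add_apply]
  exact integral_add hzF hzG

/-- **Linearity a.e.**, difference form. [folklore] -/
theorem sourceDuhamel_sub_ae {F G : ℝ × E × E → ℝ} (hFm : Measurable F) (hFi : Integrable F volume)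
    (hGm : Measurable G) (hGi : Integrable G volume) {a : ℝ} (hF : ∀ z, z.1 ≤ a → F z = 0)
    (hG : ∀ z, z.1 ≤ a → G z = 0) :
    sourceDuhamel (F - G) =ᵐ[volume] sourceDuhamel F - sourceDuhamel G := by
  filter_upwards [ae_integrableOn_shear hFm hFi hF, ae_integrableOn_shear hGm hGi hG] with z hzF hzG
  simp only [sourceDuhamel_apply, Pi.sub_apply]
  exact integral_sub hzF hzG

/-! ## The Duhamel integral solves the transport equation in `𝒟'` -/

omit [FiniteDimensional ℝ E] [MeasurableSpace E] [BorelSpace E] in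
/-- The transport derivative vanishes off the topological support (a local copy of the tree's
`transportDeriv_eq_zero_of_notMem_tsupport`, `VelocityAveragingFourier`, not imported here). [folklore] -/
private theorem transportDeriv_zero_off_tsupport {φ : ℝ × E × E → ℝ} {z : ℝ × E × E}
    (hz : z ∉ tsupport φ) : transportDeriv φ z = 0 := by
  have h : fderiv ℝ φ z = 0 := notMem_support.1 fun h => hz (support_fderiv_subset ℝ h)
  simp [transportDeriv, h]

omit [FiniteDimensional ℝ E] [MeasurableSpace E] [BorelSpace E] in
/-- The transport derivative of a compactly supported function has compact support. [folklore] -/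
theorem hasCompactSupport_transportDeriv {φ : ℝ × E × E → ℝ} (hφc : HasCompactSupport φ) :
    HasCompactSupport (transportDeriv φ) :=
  hφc.mono' fun _ hz => by_contra fun h => hz (transportDeriv_zero_off_tsupport h)

omit [FiniteDimensional ℝ E] [MeasurableSpace E] [BorelSpace E] in
/-- **Derivative along characteristics**: for differentiable `φ`,
`d/ds φ(shear (-s) w) = (Tφ)(shear (-s) w)` — the forward characteristic through `w` has
velocity `(1, ξ, 0)`. [folklore] -/
theorem hasDerivAt_comp_shear_neg {φ : ℝ × E × E → ℝ} (hφ : Differentiable ℝ φ)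
    (w : ℝ × E × E) (s : ℝ) :
    HasDerivAt (fun s : ℝ => φ (shear (-s) w)) (transportDeriv φ (shear (-s) w)) s := by
  set v : ℝ × E × E := ((1 : ℝ), w.2.2, (0 : E)) with hv
  have hfun : (fun s : ℝ => φ (shear (-s) w)) = fun s => φ (w + s • v) := by
    funext s; rw [shear_neg_eq_add_smul]
  have hγ : HasDerivAt (fun s : ℝ => w + s • v) v s := by
    simpa using ((hasDerivAt_id s).smul_const v).const_add w
  have h := (hφ (w + s • v)).hasFDerivAt.comp_hasDerivAt s hγ
  rw [hfun]
  refine h.congr_deriv ?_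
  have hw : w + s • v = shear (-s) w := by rw [shear_neg_eq_add_smul]
  rw [hw]
  simp [transportDeriv, hv]

omit [FiniteDimensional ℝ E] [MeasurableSpace E] [BorelSpace E] in
/-- **Fundamental theorem of calculus along characteristics**:
`∫_{0<s<S} (Tφ)(shear (-s) w) ds = φ(shear (-S) w) - φ(w)` for `C¹` functions and `0 ≤ S`. [folklore] -/
theorem setIntegral_transportDeriv_shear_neg {φ : ℝ × E × E → ℝ} (hφ : ContDiff ℝ ∞ φ)
    (w : ℝ × E × E) {S : ℝ} (hS : 0 ≤ S) :
    ∫ s in Ioo (0 : ℝ) S, transportDeriv φ (shear (-s) w) = φ (shear (-S) w) - φ w := by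
  have hd : Differentiable ℝ φ := hφ.differentiable (by simp)
  have hTc : Continuous (transportDeriv φ) := by
    unfold transportDeriv
    exact (hφ.continuous_fderiv (by simp)).clm_apply (by fun_prop)
  have hc : Continuous fun s : ℝ => transportDeriv φ (shear (-s) w) :=
    hTc.comp (continuous_shear_uncurry.comp (continuous_neg.prodMk continuous_const))
  rw [← integral_Ioc_eq_integral_Ioo, ← intervalIntegral.integral_of_le hS,
    intervalIntegral.integral_eq_sub_of_hasDerivAt (fun s _ => hasDerivAt_comp_shear_neg hd w s)
      (hc.intervalIntegrable _ _)]
  simp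

/-- **The Duhamel integral solves the free transport equation in `𝒟'(ℝ × E × E)`.** If `F` is
measurable, integrable and vanishes for times `≤ a`, then `u = sourceDuhamel F` satisfies
`(∂ₜ + ξ·∇ₓ) u = F` in the sense of distributions on the whole phase space-time, i.e.
`HasDistribTransportOn univ (sourceDuhamel F) F`: for every test function `φ`,
`∫ u · Tφ = -∫ F φ`. Proof: `∫ u Tφ = ∫_{0<s<S} ∫ F(shear_s z) Tφ(z) dz ds` (Fubini, the lags
being bounded on the support of `φ`) `= ∫ F(w) ∫_{0<s<S} Tφ(shear_{-s} w) ds dw` (each shear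
preserves the measure; Fubini) `= ∫ F(w) (φ(shear_{-S} w) - φ(w)) dw = -∫ F φ` (fundamental
theorem of calculus along characteristics; the boundary term vanishes since `F = 0` for `t ≤ a`
and `φ(shear_{-S} w) = 0` for `t > a` once `S` exceeds the time-width of the supports)
(CIP 1994, §5.3, p. 155; Saint-Raymond 2009, §3.3.1, method of characteristics). [cite: CIP1994, §5.3 proof of Lemma 5.3.9, p. 155] -/
theorem hasDistribTransportOn_sourceDuhamel {F : ℝ × E × E → ℝ} (hFm : Measurable F)
    (hFi : Integrable F volume) {a : ℝ} (hF : ∀ z, z.1 ≤ a → F z = 0) :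
    HasDistribTransportOn univ (sourceDuhamel F) F := by
  refine ⟨?_, ?_, fun φ hφ hφc _ => ?_⟩
  · rw [univ_prod_univ, locallyIntegrableOn_univ]
    exact locallyIntegrable_sourceDuhamel hFm hFi hF
  · rw [univ_prod_univ, locallyIntegrableOn_univ]
    exact hFi.locallyIntegrable
  ---- data of the test function
  set Tφ : ℝ × E × E → ℝ := transportDeriv φ with hTφ_def
  have hTc : Continuous Tφ := by
    rw [hTφ_def]; unfold transportDeriv
    exact (hφ.continuous_fderiv (by simp)).clm_apply (by fun_prop)
  have hT0 : ∀ z, z ∉ tsupport φ → Tφ z = 0 := fun z hz =>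
    transportDeriv_zero_off_tsupport hz
  obtain ⟨C, hC⟩ := hTc.bounded_above_of_compact_support (hasCompactSupport_transportDeriv hφc)
  have hC0 : 0 ≤ C := (norm_nonneg _).trans (hC 0)
  obtain ⟨R, hR⟩ := hφc.isCompact.isBounded.subset_closedBall (0 : ℝ × E × E)
  have hRt : ∀ z ∈ tsupport φ, z.1 ≤ R := fun z hz => by
    have h1 : ‖z‖ ≤ R := mem_closedBall_zero_iff.1 (hR hz)
    exact (le_abs_self _).trans ((Real.norm_eq_abs _ ▸ norm_fst_le z).trans h1)
  set S : ℝ := max (R - a + 1) 1 with hS_def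
  have hS0 : 0 ≤ S := zero_le_one.trans (le_max_right _ _)
  have hSt : ∀ z ∈ tsupport φ, z.1 - a ≤ S := fun z hz => by
    have := hRt z hz
    exact le_trans (by linarith) (le_max_left _ _)
  set ν : Measure ℝ := volume.restrict (Ioo (0 : ℝ) S) with hν
  haveI : IsFiniteMeasure ν := ⟨by simp [hν]⟩
  ---- Step A: only lags in `(0, S)` matter against `Tφ`
  have hA : ∀ z, sourceDuhamel F z * Tφ z = (∫ s in Ioo (0 : ℝ) S, F (shear s z)) * Tφ z := by
    intro z
    by_cases hz : z ∈ tsupport φ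
    · rw [sourceDuhamel_eq_setIntegral_Ioo hF z (hSt z hz)]
    · rw [hT0 z hz, mul_zero, mul_zero]
  ---- integrability for the two Fubini swaps
  have hmF : Measurable fun q : (ℝ × E × E) × ℝ => F (shear q.2 q.1) := measurable_comp_shear hFm
  have hIF : Integrable (fun q : (ℝ × E × E) × ℝ => F (shear q.2 q.1)) (volume.prod ν) := by
    refine ⟨hmF.aestronglyMeasurable, ?_⟩
    unfold HasFiniteIntegral
    rw [lintegral_prod _ hmF.enorm.aemeasurable]
    show ∫⁻ z, ∫⁻ s in Ioo (0 : ℝ) S, ‖F (shear s z)‖ₑ ∂volume ∂volume < ⊤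
    rw [lintegral_lintegral_shear_eq hFm]
    exact ENNReal.mul_lt_top ENNReal.ofReal_lt_top hFi.2
  have hint1 : Integrable (uncurry fun (z : ℝ × E × E) (s : ℝ) => F (shear s z) * Tφ z)
      (volume.prod ν) := by
    refine (hIF.norm.mul_const C).mono' ?_ (ae_of_all _ fun q => ?_)
    · exact (hmF.mul (hTc.measurable.comp measurable_fst)).aestronglyMeasurable
    · simp only [uncurry, norm_mul]
      exact mul_le_mul_of_nonneg_left (hC _) (norm_nonneg _)
  have hmT : Measurable fun q : (ℝ × E × E) × ℝ => Tφ (shear (-q.2) q.1) :=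
    (hTc.comp (continuous_shear_uncurry.comp
      ((continuous_neg.comp continuous_snd).prodMk continuous_fst))).measurable
  have hint2 : Integrable (uncurry fun (w : ℝ × E × E) (s : ℝ) => F w * Tφ (shear (-s) w))
      (volume.prod ν) := by
    refine ((hFi.comp_fst ν).norm.mul_const C).mono' ?_ (ae_of_all _ fun q => ?_)
    · exact ((hFm.comp measurable_fst).mul hmT).aestronglyMeasurable
    · simp only [uncurry, norm_mul]
      exact mul_le_mul_of_nonneg_left (hC _) (norm_nonneg _)
  ---- the boundary term vanishes
  have hvanish : ∀ w, F w * φ (shear (-S) w) = 0 := by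
    intro w
    by_cases hw : w.1 ≤ a
    · rw [hF w hw, zero_mul]
    · have hφ0 : φ (shear (-S) w) = 0 := by
        refine image_eq_zero_of_notMem_tsupport fun h => ?_
        have h1 := hRt _ h
        simp only [shear] at h1
        have h2 : R - a + 1 ≤ S := le_max_left _ _
        push Not at hw
        linarith
      rw [hφ0, mul_zero]
  ---- the computation
  calc ∫ z, sourceDuhamel F z * Tφ z
      = ∫ z, (∫ s in Ioo (0 : ℝ) S, F (shear s z)) * Tφ z := by simp_rw [hA]
    _ = ∫ z, ∫ s in Ioo (0 : ℝ) S, F (shear s z) * Tφ z := by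
        simp_rw [MeasureTheory.integral_mul_const]
    _ = ∫ s in Ioo (0 : ℝ) S, ∫ z, F (shear s z) * Tφ z := integral_integral_swap hint1
    _ = ∫ s in Ioo (0 : ℝ) S, ∫ w, F w * Tφ (shear (-s) w) := by
        refine setIntegral_congr_fun measurableSet_Ioo fun s _ => ?_
        have h := (measurePreserving_shear (E := E) s).integral_comp
          (shearEquiv s).measurableEmbedding (fun w => F w * Tφ (shear (-s) w))
        rw [← h]
        congr 1
        funext z
        rw [shear_shear, neg_add_cancel, shear_zero]
    _ = ∫ w, ∫ s in Ioo (0 : ℝ) S, F w * Tφ (shear (-s) w) := (integral_integral_swap hint2).symm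
    _ = ∫ w, F w * (φ (shear (-S) w) - φ w) := by
        congr 1
        funext w
        rw [MeasureTheory.integral_const_mul, setIntegral_transportDeriv_shear_neg hφ w hS0]
    _ = ∫ w, -(F w * φ w) := by
        congr 1
        funext w
        rw [mul_sub, hvanish w, zero_sub]
    _ = -∫ w, F w * φ w := integral_neg _

end Volume

end Literature.MathematicalPhysics.KineticTheory
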